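import Summits.QuantumFields.YangMills.Theorems.FluctuationComparisonRegPrIntLS2BetaSectionsFaceDatumStep
import HarnessLib

/-!
# S2β · D-GUARD ∕ (BG∞) — (L-Σ) PART 4∕5: (STEP) BY THREE ROUNDS — stage-1, -2, -3 sections are `(A_s∕ρ)`-slow given the filling letters' Lipschitz clauses (UV3-NODE §116 ADD.2)

Cell `ym3-torus` (YM ladder rung R3 = continuum `SU(2)` Yang–Mills on the three-torus at fixed lattice data — a RUNG: NOT d = 4, NOT infinite volume,
NOT a mass gap, NOT Clay).  Width seat «width 19» `ym3-torus-px19` (gen 25, ★p1 lineage), FREE px helper on crux `stmt-QuantumFields-20520`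
(`FluctuationComparisonRegPrIntL`; registry `Lines/semiclassical_s2beta.lean` UNTOUCHED, 0∕5); `--kind proof --supports stmt-QuantumFields-20520 --as helper`,
count-neutral, DEFINITION-FREE (0 `def`, 0 `instance`, 0 `notation`, 0 `sorry`, default heartbeats).  (BG∞) plan of record: UV3-NODE §116 + ADD.1 + ADD.2
(architect ruling px17 g23 2026-09-01T00:13:02Z; desk RULINGs №123 ∕ №127 (binder style) ∕ №132-A; LEAD RULINGs №66 ∕ №67).

WHY.  Round `s`: blocks of stage `< s` have `(B_{s−1}∕ρ)`-slow sections (`B₀ = 0`, `B₁ = max 0 A₁`, `B₂ = max B₁ A₂`), so by ✓`face_datum_step` the face datum of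
a stage-`s` block is `(B_{s−1}∕ρ + η)`-slow, which is within the letter's input scale `ε_s`; the letter's Lipschitz clause (displayed: `hL1`, `hL2`, `hL3`) then makes
the stage-`s` filling `(A_s∕ρ)`-slow, and the table says the section IS that filling.

WHAT IS PROVED (sorry-free).  `st_le_three`, `colour0∕1∕2∕3_of_st` (colours from the indicator sum); `step_stage0` (`= 0`), ★`step_stage1`, ★`step_stage2`,
★`step_stage3`.

HONEST SCOPE.  Bookkeeping and group algebra over DISPLAYED hypotheses (the eight-colour table and the filling data are carried as functions PINNED by displayed
equations, in the style of ✓p839983's `hW`; nothing is defined).  The three FILLING LETTERS are HYPOTHESES of the final theorem (file (Σ-B5)); until they are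
discharged ((L-I) ✓p839983, (L-T)∕(R3) px5, (L-S) px8, with the cone-centre lemmas (B3′)∕(B3-S)) `hSec`, hence `hBG`, (BG∞), `hsupp⁺` and D-GUARD's two `hsupp`
letters are NOT proved.  Nothing of Bałaban's renormalisation-group analysis is asserted or proved ([Balaban1985RegularSpaces] Lemma 1 p.79 ∕ (1.29) p.81 is the
local, non-uniform statement in print; the N-uniform torus gluing is the (BG∞) plan's, NOT in print).  GAP♯∘ (`stub_uniformFibreGapOrbit`, registry UNTOUCHED), the
five registered stubs (0∕5), S2β, 20520, 19936, 19200, `YM3TorusSU2` are NOT proved; no registered stub is closed; rung R3 — NOT d = 4, NOT infinite volume, NOT a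
mass gap, NOT Clay; the Yang–Mills mass gap is NOT proved.  Axioms standard.

References: T. Bałaban, CMP **99** (1985) 75–102 [Balaban1985RegularSpaces] (Lemma 1 p.79, (1.29) p.81).
-/

set_option autoImplicit false

namespace Summit.QuantumFields.YangMills.Theorems.FluctuationComparisonRegPrIntLS2BetaSectionsStageSteps

open Literature.MathematicalPhysics.QuantumFieldTheory.Balaban1983to89
open T4CubeChartGnomonic (SU2)
open Summit.QuantumFields.YangMills.Theorems.FluctuationComparisonRegPrIntLS2BetaDescendedBlock
open Summit.QuantumFields.YangMills.Theorems.FluctuationComparisonRegPrIntLS2BetaSectionsColourTable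
open Summit.QuantumFields.YangMills.Theorems.FluctuationComparisonRegPrIntLS2BetaSectionsDescentConsistency
open Summit.QuantumFields.YangMills.Theorems.FluctuationComparisonRegPrIntLS2BetaSectionsFaceDatumStep

section Blocks
variable {P : Params} {M : ℕ} (len start : Fin M → ℕ)
  (hlen1 : ∀ i, 1 ≤ len i)
  (hz : ∀ i : Fin M, (i : ℕ) = 0 → start i = 0)
  (hs : ∀ i j : Fin M, (j : ℕ) = (i : ℕ) + 1 → start j = start i + len i)
  (hl : ∀ i : Fin M, (i : ℕ) + 1 = M → start i + len i = P.sitesPerDir 0) (hM : 3 ≤ M) (hEven : Even M)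
  (D : Fin M → ZMod (P.sitesPerDir 0) → Fin M)
  (hD : ∀ (i : Fin M) (v : ZMod (P.sitesPerDir 0)),
      ((i : ℕ) % 2 = 1 ∧ (v - ((start i : ℕ) : ZMod (P.sitesPerDir 0))).val = 0 ∧ ((i : ℕ) = (D i v : ℕ) + 1 ∨ ((D i v : ℕ) + 1 = M ∧ (i : ℕ) = 0))) ∨
      ((i : ℕ) % 2 = 1 ∧ (v - ((start i : ℕ) : ZMod (P.sitesPerDir 0))).val = len i ∧ ((D i v : ℕ) = (i : ℕ) + 1 ∨ ((i : ℕ) + 1 = M ∧ (D i v : ℕ) = 0))) ∨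
      (¬ ((i : ℕ) % 2 = 1 ∧ ((v - ((start i : ℕ) : ZMod (P.sitesPerDir 0))).val = 0 ∨ (v - ((start i : ℕ) : ZMod (P.sitesPerDir 0))).val = len i)) ∧
        D i v = i))
  (κ0 κ1 κ2 : Fin P.d) (htri : ∀ κ : Fin P.d, κ = κ0 ∨ κ = κ1 ∨ κ = κ2)
  (g : (Fin P.d → Fin M) → Site P 0 → SU2)
  (W₁ : (Fin P.d → Fin M) → Fin P.d → Site P 0 → SU2)
  (W₂ : (Fin P.d → Fin M) → Fin P.d → Fin P.d → Site P 0 → SU2)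
  (W₃ : (Fin P.d → Fin M) → Site P 0 → SU2)
  (wle1 wle2 w : (Fin P.d → Fin M) → Site P 0 → SU2)
  (hwle1 : ∀ R x, wle1 R x =
    if ((R κ0 : Fin M) : ℕ) % 2 = 1 then (if ((R κ1 : Fin M) : ℕ) % 2 = 1 then 1 else if ((R κ2 : Fin M) : ℕ) % 2 = 1 then 1 else W₁ R κ0 x)
    else (if ((R κ1 : Fin M) : ℕ) % 2 = 1 then (if ((R κ2 : Fin M) : ℕ) % 2 = 1 then 1 else W₁ R κ1 x)
      else (if ((R κ2 : Fin M) : ℕ) % 2 = 1 then W₁ R κ2 x else 1)))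
  (hwle2 : ∀ R x, wle2 R x =
    if ((R κ0 : Fin M) : ℕ) % 2 = 1 then (if ((R κ1 : Fin M) : ℕ) % 2 = 1 then (if ((R κ2 : Fin M) : ℕ) % 2 = 1 then 1 else W₂ R κ0 κ1 x)
      else (if ((R κ2 : Fin M) : ℕ) % 2 = 1 then W₂ R κ0 κ2 x else W₁ R κ0 x))
    else (if ((R κ1 : Fin M) : ℕ) % 2 = 1 then (if ((R κ2 : Fin M) : ℕ) % 2 = 1 then W₂ R κ1 κ2 x else W₁ R κ1 x)
      else (if ((R κ2 : Fin M) : ℕ) % 2 = 1 then W₁ R κ2 x else 1)))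
  (hw : ∀ R x, w R x =
    if ((R κ0 : Fin M) : ℕ) % 2 = 1 then (if ((R κ1 : Fin M) : ℕ) % 2 = 1 then (if ((R κ2 : Fin M) : ℕ) % 2 = 1 then W₃ R x else W₂ R κ0 κ1 x)
      else (if ((R κ2 : Fin M) : ℕ) % 2 = 1 then W₂ R κ0 κ2 x else W₁ R κ0 x))
    else (if ((R κ1 : Fin M) : ℕ) % 2 = 1 then (if ((R κ2 : Fin M) : ℕ) % 2 = 1 then W₂ R κ1 κ2 x else W₁ R κ1 x)
      else (if ((R κ2 : Fin M) : ℕ) % 2 = 1 then W₁ R κ2 x else 1)))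
  (hA1 : ∀ (Q : Fin P.d → Fin M) (α : Fin P.d) (x : Site P 0),
      (∀ κ, (x κ - ((start (Q κ) : ℕ) : ZMod (P.sitesPerDir 0))).val ≤ len (Q κ)) →
      ((x α - ((start (Q α) : ℕ) : ZMod (P.sitesPerDir 0))).val = 0 ∨ (x α - ((start (Q α) : ℕ) : ZMod (P.sitesPerDir 0))).val = len (Q α)) →
      W₁ Q α x = g (fun κ => D (Q κ) (x κ)) x * (g Q x)⁻¹)
  (hA2 : ∀ (Q : Fin P.d → Fin M) (α β : Fin P.d) (x : Site P 0),
      (∀ κ, (x κ - ((start (Q κ) : ℕ) : ZMod (P.sitesPerDir 0))).val ≤ len (Q κ)) →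
      (((x α - ((start (Q α) : ℕ) : ZMod (P.sitesPerDir 0))).val = 0 ∨ (x α - ((start (Q α) : ℕ) : ZMod (P.sitesPerDir 0))).val = len (Q α)) ∨
        ((x β - ((start (Q β) : ℕ) : ZMod (P.sitesPerDir 0))).val = 0 ∨ (x β - ((start (Q β) : ℕ) : ZMod (P.sitesPerDir 0))).val = len (Q β))) →
      W₂ Q α β x = wle1 (fun κ => D (Q κ) (x κ)) x * g (fun κ => D (Q κ) (x κ)) x * (g Q x)⁻¹)
  (hA3 : ∀ (Q : Fin P.d → Fin M) (x : Site P 0),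
      (∀ κ, (x κ - ((start (Q κ) : ℕ) : ZMod (P.sitesPerDir 0))).val ≤ len (Q κ)) →
      (∃ κ, (x κ - ((start (Q κ) : ℕ) : ZMod (P.sitesPerDir 0))).val = 0 ∨ (x κ - ((start (Q κ) : ℕ) : ZMod (P.sitesPerDir 0))).val = len (Q κ)) →
      W₃ Q x = wle2 (fun κ => D (Q κ) (x κ)) x * g (fun κ => D (Q κ) (x κ)) x * (g Q x)⁻¹)
variable (st : (Fin P.d → Fin M) → ℕ)
  (hst : ∀ R, st R = (if ((R κ0 : Fin M) : ℕ) % 2 = 1 then 1 else 0) + (if ((R κ1 : Fin M) : ℕ) % 2 = 1 then 1 else 0) +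
    (if ((R κ2 : Fin M) : ℕ) % 2 = 1 then 1 else 0))

/-! ## §5 Colours from the stage count -/

include hst in
/-- The stage is at most three. [folklore] -/
theorem st_le_three (Q : Fin P.d → Fin M) : st Q ≤ 3 := by
  rw [hst]; split_ifs <;> omega

include hst in
/-- Stage 0 = colour `(0,0,0)`. [folklore] -/
theorem colour0_of_st (Q : Fin P.d → Fin M) (h : st Q = 0) :
    ¬ ((Q κ0 : Fin M) : ℕ) % 2 = 1 ∧ ¬ ((Q κ1 : Fin M) : ℕ) % 2 = 1 ∧ ¬ ((Q κ2 : Fin M) : ℕ) % 2 = 1 := by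
  rw [hst] at h; split_ifs at h <;> omega

include hst in
/-- Stage 1 = one odd axis. [folklore] -/
theorem colour1_of_st (Q : Fin P.d → Fin M) (h : st Q = 1) : ∃ α : Fin P.d,
    (α = κ0 ∧ ((Q κ0 : Fin M) : ℕ) % 2 = 1 ∧ ¬ ((Q κ1 : Fin M) : ℕ) % 2 = 1 ∧ ¬ ((Q κ2 : Fin M) : ℕ) % 2 = 1) ∨
    (α = κ1 ∧ ¬ ((Q κ0 : Fin M) : ℕ) % 2 = 1 ∧ ((Q κ1 : Fin M) : ℕ) % 2 = 1 ∧ ¬ ((Q κ2 : Fin M) : ℕ) % 2 = 1) ∨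
    (α = κ2 ∧ ¬ ((Q κ0 : Fin M) : ℕ) % 2 = 1 ∧ ¬ ((Q κ1 : Fin M) : ℕ) % 2 = 1 ∧ ((Q κ2 : Fin M) : ℕ) % 2 = 1) := by
  rw [hst] at h
  by_cases o0 : ((Q κ0 : Fin M) : ℕ) % 2 = 1 <;> by_cases o1 : ((Q κ1 : Fin M) : ℕ) % 2 = 1 <;>
    by_cases o2 : ((Q κ2 : Fin M) : ℕ) % 2 = 1 <;> simp only [o0, o1, o2, if_true, if_false] at h <;>
    first | (exfalso; omega) | exact ⟨κ0, Or.inl ⟨rfl, o0, o1, o2⟩⟩ | exact ⟨κ1, Or.inr (Or.inl ⟨rfl, o0, o1, o2⟩)⟩ |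
      exact ⟨κ2, Or.inr (Or.inr ⟨rfl, o0, o1, o2⟩)⟩

include hst in
/-- Stage 2 = two odd axes. [folklore] -/
theorem colour2_of_st (Q : Fin P.d → Fin M) (h : st Q = 2) : ∃ α β : Fin P.d,
    (α = κ0 ∧ β = κ1 ∧ ((Q κ0 : Fin M) : ℕ) % 2 = 1 ∧ ((Q κ1 : Fin M) : ℕ) % 2 = 1 ∧ ¬ ((Q κ2 : Fin M) : ℕ) % 2 = 1) ∨
    (α = κ0 ∧ β = κ2 ∧ ((Q κ0 : Fin M) : ℕ) % 2 = 1 ∧ ¬ ((Q κ1 : Fin M) : ℕ) % 2 = 1 ∧ ((Q κ2 : Fin M) : ℕ) % 2 = 1) ∨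
    (α = κ1 ∧ β = κ2 ∧ ¬ ((Q κ0 : Fin M) : ℕ) % 2 = 1 ∧ ((Q κ1 : Fin M) : ℕ) % 2 = 1 ∧ ((Q κ2 : Fin M) : ℕ) % 2 = 1) := by
  rw [hst] at h
  by_cases o0 : ((Q κ0 : Fin M) : ℕ) % 2 = 1 <;> by_cases o1 : ((Q κ1 : Fin M) : ℕ) % 2 = 1 <;>
    by_cases o2 : ((Q κ2 : Fin M) : ℕ) % 2 = 1 <;> simp only [o0, o1, o2, if_true, if_false] at h <;>
    first | (exfalso; omega) | exact ⟨κ0, κ1, Or.inl ⟨rfl, rfl, o0, o1, o2⟩⟩ | exact ⟨κ0, κ2, Or.inr (Or.inl ⟨rfl, rfl, o0, o1, o2⟩)⟩ |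
      exact ⟨κ1, κ2, Or.inr (Or.inr ⟨rfl, rfl, o0, o1, o2⟩)⟩

include hst in
/-- Stage 3 = colour `(1,1,1)`. [folklore] -/
theorem colour3_of_st (Q : Fin P.d → Fin M) (h : st Q = 3) :
    ((Q κ0 : Fin M) : ℕ) % 2 = 1 ∧ ((Q κ1 : Fin M) : ℕ) % 2 = 1 ∧ ((Q κ2 : Fin M) : ℕ) % 2 = 1 := by
  rw [hst] at h; split_ifs at h <;> omega

/-! ## §6 (STEP) by three rounds -/

include hw hst in
/-- Stage 0: the section is `1`, its steps vanish. [folklore] -/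
theorem step_stage0 (Q : Fin P.d → Fin M) (h : st Q = 0) (x y : Site P 0) : dist1 (w Q x * (w Q y)⁻¹) = 0 := by
  obtain ⟨h0, h1, h2⟩ := colour0_of_st κ0 κ1 κ2 st hst Q h
  rw [w_eq_one κ0 κ1 κ2 W₁ W₂ W₃ w hw Q x h0 h1 h2, w_eq_one κ0 κ1 κ2 W₁ W₂ W₃ w hw Q y h0 h1 h2, inv_one, mul_one,
    GaugeGroup.dist1_one]

include hlen1 hz hs hl hM hEven hD htri hwle1 hwle2 hw hA1 hA2 hA3 hst in
/-- ★★ **(STEP₁)** stage-1 blocks: the face datum `g_{D}·g_Q⁻¹` moves by `≤ η ≤ ε₁` on the two odd faces (round with `B = 0`), so the stage-1 filling letter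
gives `(A₁∕ρ)`-Lipschitz sections. [folklore] -/
theorem step_stage1 (hlen2 : ∀ i, 2 ≤ len i) (hN : ∀ i, len i + 1 < P.sitesPerDir 0) {A₁ ε₁ η : ℝ} {ρ : ℕ}
    (hTrans : ∀ (Q Q' : Fin P.d → Fin M) (b : PBond P 0),
      (∀ κ, (b.src κ - ((start (Q κ) : ℕ) : ZMod (P.sitesPerDir 0))).val ≤ len (Q κ)) →
      (∀ κ, (b.tgt κ - ((start (Q κ) : ℕ) : ZMod (P.sitesPerDir 0))).val ≤ len (Q κ)) →
      (∀ κ, (b.src κ - ((start (Q' κ) : ℕ) : ZMod (P.sitesPerDir 0))).val ≤ len (Q' κ)) →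
      (∀ κ, (b.tgt κ - ((start (Q' κ) : ℕ) : ZMod (P.sitesPerDir 0))).val ≤ len (Q' κ)) →
      dist1 ((g Q b.src * (g Q' b.src)⁻¹)⁻¹ * (g Q b.tgt * (g Q' b.tgt)⁻¹)) ≤ η)
    (hL1 : ∀ (Q : Fin P.d → Fin M) (α : Fin P.d),
      (∀ b : PBond P 0, (∀ κ, (b.src κ - ((start (Q κ) : ℕ) : ZMod (P.sitesPerDir 0))).val ≤ len (Q κ)) →
        (∀ κ, (b.tgt κ - ((start (Q κ) : ℕ) : ZMod (P.sitesPerDir 0))).val ≤ len (Q κ)) →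
        ((b.src α - ((start (Q α) : ℕ) : ZMod (P.sitesPerDir 0))).val = 0 ∨ (b.src α - ((start (Q α) : ℕ) : ZMod (P.sitesPerDir 0))).val = len (Q α)) →
        ((b.tgt α - ((start (Q α) : ℕ) : ZMod (P.sitesPerDir 0))).val = 0 ∨ (b.tgt α - ((start (Q α) : ℕ) : ZMod (P.sitesPerDir 0))).val = len (Q α)) →
        dist1 ((g (fun κ => D (Q κ) (b.src κ)) b.src * (g Q b.src)⁻¹) * (g (fun κ => D (Q κ) (b.tgt κ)) b.tgt * (g Q b.tgt)⁻¹)⁻¹) ≤ ε₁) →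
      ∀ b : PBond P 0, (∀ κ, (b.src κ - ((start (Q κ) : ℕ) : ZMod (P.sitesPerDir 0))).val ≤ len (Q κ)) →
        (∀ κ, (b.tgt κ - ((start (Q κ) : ℕ) : ZMod (P.sitesPerDir 0))).val ≤ len (Q κ)) →
        dist1 (W₁ Q α b.src * (W₁ Q α b.tgt)⁻¹) ≤ A₁ / ρ)
    (hε₁ : η ≤ ε₁) (Q : Fin P.d → Fin M) (hQ : st Q = 1) (b : PBond P 0)
    (hbs : ∀ κ, (b.src κ - ((start (Q κ) : ℕ) : ZMod (P.sitesPerDir 0))).val ≤ len (Q κ))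
    (hbt : ∀ κ, (b.tgt κ - ((start (Q κ) : ℕ) : ZMod (P.sitesPerDir 0))).val ≤ len (Q κ)) :
    dist1 (w Q b.src * (w Q b.tgt)⁻¹) ≤ A₁ / ρ := by
  obtain ⟨α, hα⟩ := colour1_of_st κ0 κ1 κ2 st hst Q hQ
  have hoα : ((Q α : Fin M) : ℕ) % 2 = 1 := by
    rcases hα with ⟨hαe, h0, h1, h2⟩ | ⟨hαe, h0, h1, h2⟩ | ⟨hαe, h0, h1, h2⟩ <;> rw [hαe] <;> assumption
  rw [w_eq_W1 κ0 κ1 κ2 W₁ W₂ W₃ w hw Q b.src α hα, w_eq_W1 κ0 κ1 κ2 W₁ W₂ W₃ w hw Q b.tgt α hα]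
  refine hL1 Q α (fun b' hs' ht' hfs hft => ?_) b hbs hbt
  -- the face datum through the round lemma with `B = 0`
  have hround := face_datum_step len start hlen1 hz hs hl hM hEven D hD κ0 κ1 κ2 htri g W₁ W₂ W₃ wle1 wle2 w hwle1 hwle2 hw hA1 hA2 hA3
    st hst hlen2 hN (B := 0) (ρ := ρ) hTrans Q (fun R hR b'' hs'' ht'' => ?_) b' hs' ht' ⟨α, hoα, hfs⟩ ⟨α, hoα, hft⟩
  · rw [dkey1 len start hEven D hD κ0 κ1 κ2 W₁ W₂ W₃ w hw Q b'.src α hα hfs,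
      dkey1 len start hEven D hD κ0 κ1 κ2 W₁ W₂ W₃ w hw Q b'.tgt α hα hft, one_mul, one_mul] at hround
    have : (0 : ℝ) / ρ = 0 := zero_div _
    linarith
  · have hR0 : st R = 0 := by omega
    rw [step_stage0 κ0 κ1 κ2 W₁ W₂ W₃ w hw st hst R hR0, zero_div]


include hlen1 hz hs hl hM hEven hD htri hwle1 hwle2 hw hA1 hA2 hA3 hst in
/-- ★★ **(STEP₂)** stage-2 blocks: the tube datum moves by `≤ B₁∕ρ + η ≤ ε₂` (round with the stage-≤1 bound `B₁`), so the stage-2 filling letter gives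
`(A₂∕ρ)`-Lipschitz sections. [folklore] -/
theorem step_stage2 (hlen2 : ∀ i, 2 ≤ len i) (hN : ∀ i, len i + 1 < P.sitesPerDir 0) {A₂ ε₂ η B₁ : ℝ} {ρ : ℕ}
    (h01 : κ0 ≠ κ1) (h02 : κ0 ≠ κ2) (h12 : κ1 ≠ κ2)
    (hTrans : ∀ (Q Q' : Fin P.d → Fin M) (b : PBond P 0),
      (∀ κ, (b.src κ - ((start (Q κ) : ℕ) : ZMod (P.sitesPerDir 0))).val ≤ len (Q κ)) →
      (∀ κ, (b.tgt κ - ((start (Q κ) : ℕ) : ZMod (P.sitesPerDir 0))).val ≤ len (Q κ)) →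
      (∀ κ, (b.src κ - ((start (Q' κ) : ℕ) : ZMod (P.sitesPerDir 0))).val ≤ len (Q' κ)) →
      (∀ κ, (b.tgt κ - ((start (Q' κ) : ℕ) : ZMod (P.sitesPerDir 0))).val ≤ len (Q' κ)) →
      dist1 ((g Q b.src * (g Q' b.src)⁻¹)⁻¹ * (g Q b.tgt * (g Q' b.tgt)⁻¹)) ≤ η)
    (hL2 : ∀ (Q : Fin P.d → Fin M) (α β : Fin P.d), α ≠ β →
      (∀ b : PBond P 0, (∀ κ, (b.src κ - ((start (Q κ) : ℕ) : ZMod (P.sitesPerDir 0))).val ≤ len (Q κ)) →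
        (∀ κ, (b.tgt κ - ((start (Q κ) : ℕ) : ZMod (P.sitesPerDir 0))).val ≤ len (Q κ)) →
        (((b.src α - ((start (Q α) : ℕ) : ZMod (P.sitesPerDir 0))).val = 0 ∨ (b.src α - ((start (Q α) : ℕ) : ZMod (P.sitesPerDir 0))).val = len (Q α)) ∨
          ((b.src β - ((start (Q β) : ℕ) : ZMod (P.sitesPerDir 0))).val = 0 ∨ (b.src β - ((start (Q β) : ℕ) : ZMod (P.sitesPerDir 0))).val = len (Q β))) →
        (((b.tgt α - ((start (Q α) : ℕ) : ZMod (P.sitesPerDir 0))).val = 0 ∨ (b.tgt α - ((start (Q α) : ℕ) : ZMod (P.sitesPerDir 0))).val = len (Q α)) ∨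
          ((b.tgt β - ((start (Q β) : ℕ) : ZMod (P.sitesPerDir 0))).val = 0 ∨ (b.tgt β - ((start (Q β) : ℕ) : ZMod (P.sitesPerDir 0))).val = len (Q β))) →
        dist1 ((wle1 (fun κ => D (Q κ) (b.src κ)) b.src * g (fun κ => D (Q κ) (b.src κ)) b.src * (g Q b.src)⁻¹) *
          (wle1 (fun κ => D (Q κ) (b.tgt κ)) b.tgt * g (fun κ => D (Q κ) (b.tgt κ)) b.tgt * (g Q b.tgt)⁻¹)⁻¹) ≤ ε₂) →
      ∀ b : PBond P 0, (∀ κ, (b.src κ - ((start (Q κ) : ℕ) : ZMod (P.sitesPerDir 0))).val ≤ len (Q κ)) →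
        (∀ κ, (b.tgt κ - ((start (Q κ) : ℕ) : ZMod (P.sitesPerDir 0))).val ≤ len (Q κ)) →
        dist1 (W₂ Q α β b.src * (W₂ Q α β b.tgt)⁻¹) ≤ A₂ / ρ)
    (hlow : ∀ R : Fin P.d → Fin M, st R < 2 → ∀ b : PBond P 0,
      (∀ κ, (b.src κ - ((start (R κ) : ℕ) : ZMod (P.sitesPerDir 0))).val ≤ len (R κ)) →
      (∀ κ, (b.tgt κ - ((start (R κ) : ℕ) : ZMod (P.sitesPerDir 0))).val ≤ len (R κ)) →
      dist1 (w R b.src * (w R b.tgt)⁻¹) ≤ B₁ / ρ)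
    (hε₂ : B₁ / ρ + η ≤ ε₂) (Q : Fin P.d → Fin M) (hQ : st Q = 2) (b : PBond P 0)
    (hbs : ∀ κ, (b.src κ - ((start (Q κ) : ℕ) : ZMod (P.sitesPerDir 0))).val ≤ len (Q κ))
    (hbt : ∀ κ, (b.tgt κ - ((start (Q κ) : ℕ) : ZMod (P.sitesPerDir 0))).val ≤ len (Q κ)) :
    dist1 (w Q b.src * (w Q b.tgt)⁻¹) ≤ A₂ / ρ := by
  obtain ⟨α, β, hαβ⟩ := colour2_of_st κ0 κ1 κ2 st hst Q hQ
  have hne : α ≠ β := by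
    rcases hαβ with ⟨hαe, hβe, -⟩ | ⟨hαe, hβe, -⟩ | ⟨hαe, hβe, -⟩ <;> rw [hαe, hβe] <;> assumption
  have hoα : ((Q α : Fin M) : ℕ) % 2 = 1 := by
    rcases hαβ with ⟨hαe, -, h0, h1, h2⟩ | ⟨hαe, -, h0, h1, h2⟩ | ⟨hαe, -, h0, h1, h2⟩ <;> rw [hαe] <;> assumption
  have hoβ : ((Q β : Fin M) : ℕ) % 2 = 1 := by
    rcases hαβ with ⟨-, hβe, h0, h1, h2⟩ | ⟨-, hβe, h0, h1, h2⟩ | ⟨-, hβe, h0, h1, h2⟩ <;> rw [hβe] <;> assumption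
  rw [w_eq_W2 κ0 κ1 κ2 W₁ W₂ W₃ w hw Q b.src α β hαβ, w_eq_W2 κ0 κ1 κ2 W₁ W₂ W₃ w hw Q b.tgt α β hαβ]
  refine hL2 Q α β hne (fun b' hs' ht' hfs hft => ?_) b hbs hbt
  have hFs : ∃ κ, ((Q κ : Fin M) : ℕ) % 2 = 1 ∧ ((b'.src κ - ((start (Q κ) : ℕ) : ZMod (P.sitesPerDir 0))).val = 0 ∨
      (b'.src κ - ((start (Q κ) : ℕ) : ZMod (P.sitesPerDir 0))).val = len (Q κ)) := by
    rcases hfs with h | h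
    · exact ⟨α, hoα, h⟩
    · exact ⟨β, hoβ, h⟩
  have hFt : ∃ κ, ((Q κ : Fin M) : ℕ) % 2 = 1 ∧ ((b'.tgt κ - ((start (Q κ) : ℕ) : ZMod (P.sitesPerDir 0))).val = 0 ∨
      (b'.tgt κ - ((start (Q κ) : ℕ) : ZMod (P.sitesPerDir 0))).val = len (Q κ)) := by
    rcases hft with h | h
    · exact ⟨α, hoα, h⟩
    · exact ⟨β, hoβ, h⟩
  have hround := face_datum_step len start hlen1 hz hs hl hM hEven D hD κ0 κ1 κ2 htri g W₁ W₂ W₃ wle1 wle2 w hwle1 hwle2 hw hA1 hA2 hA3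
    st hst hlen2 hN (B := B₁) (ρ := ρ) hTrans Q (fun R hR b'' hs'' ht'' => hlow R (by omega) b'' hs'' ht'') b' hs' ht' hFs hFt
  rw [dkey2 len start hEven D hD κ0 κ1 κ2 W₁ W₂ W₃ wle1 w hwle1 hw Q b'.src α β hαβ hfs,
    dkey2 len start hEven D hD κ0 κ1 κ2 W₁ W₂ W₃ wle1 w hwle1 hw Q b'.tgt α β hαβ hft]
  linarith

include hlen1 hz hs hl hM hEven hD htri hwle1 hwle2 hw hA1 hA2 hA3 hst in
/-- ★★ **(STEP₃)** stage-3 blocks: the shell datum moves by `≤ B₂∕ρ + η ≤ ε₃` (round with the stage-≤2 bound `B₂`), so the stage-3 filling letter gives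
`(A₃∕ρ)`-Lipschitz sections. [folklore] -/
theorem step_stage3 (hlen2 : ∀ i, 2 ≤ len i) (hN : ∀ i, len i + 1 < P.sitesPerDir 0) {A₃ ε₃ η B₂ : ℝ} {ρ : ℕ}
    (hTrans : ∀ (Q Q' : Fin P.d → Fin M) (b : PBond P 0),
      (∀ κ, (b.src κ - ((start (Q κ) : ℕ) : ZMod (P.sitesPerDir 0))).val ≤ len (Q κ)) →
      (∀ κ, (b.tgt κ - ((start (Q κ) : ℕ) : ZMod (P.sitesPerDir 0))).val ≤ len (Q κ)) →
      (∀ κ, (b.src κ - ((start (Q' κ) : ℕ) : ZMod (P.sitesPerDir 0))).val ≤ len (Q' κ)) →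
      (∀ κ, (b.tgt κ - ((start (Q' κ) : ℕ) : ZMod (P.sitesPerDir 0))).val ≤ len (Q' κ)) →
      dist1 ((g Q b.src * (g Q' b.src)⁻¹)⁻¹ * (g Q b.tgt * (g Q' b.tgt)⁻¹)) ≤ η)
    (hL3 : ∀ (Q : Fin P.d → Fin M),
      (∀ b : PBond P 0, (∀ κ, (b.src κ - ((start (Q κ) : ℕ) : ZMod (P.sitesPerDir 0))).val ≤ len (Q κ)) →
        (∀ κ, (b.tgt κ - ((start (Q κ) : ℕ) : ZMod (P.sitesPerDir 0))).val ≤ len (Q κ)) →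
        (∃ κ, (b.src κ - ((start (Q κ) : ℕ) : ZMod (P.sitesPerDir 0))).val = 0 ∨ (b.src κ - ((start (Q κ) : ℕ) : ZMod (P.sitesPerDir 0))).val = len (Q κ)) →
        (∃ κ, (b.tgt κ - ((start (Q κ) : ℕ) : ZMod (P.sitesPerDir 0))).val = 0 ∨ (b.tgt κ - ((start (Q κ) : ℕ) : ZMod (P.sitesPerDir 0))).val = len (Q κ)) →
        dist1 ((wle2 (fun κ => D (Q κ) (b.src κ)) b.src * g (fun κ => D (Q κ) (b.src κ)) b.src * (g Q b.src)⁻¹) *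
          (wle2 (fun κ => D (Q κ) (b.tgt κ)) b.tgt * g (fun κ => D (Q κ) (b.tgt κ)) b.tgt * (g Q b.tgt)⁻¹)⁻¹) ≤ ε₃) →
      ∀ b : PBond P 0, (∀ κ, (b.src κ - ((start (Q κ) : ℕ) : ZMod (P.sitesPerDir 0))).val ≤ len (Q κ)) →
        (∀ κ, (b.tgt κ - ((start (Q κ) : ℕ) : ZMod (P.sitesPerDir 0))).val ≤ len (Q κ)) →
        dist1 (W₃ Q b.src * (W₃ Q b.tgt)⁻¹) ≤ A₃ / ρ)
    (hlow : ∀ R : Fin P.d → Fin M, st R < 3 → ∀ b : PBond P 0,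
      (∀ κ, (b.src κ - ((start (R κ) : ℕ) : ZMod (P.sitesPerDir 0))).val ≤ len (R κ)) →
      (∀ κ, (b.tgt κ - ((start (R κ) : ℕ) : ZMod (P.sitesPerDir 0))).val ≤ len (R κ)) →
      dist1 (w R b.src * (w R b.tgt)⁻¹) ≤ B₂ / ρ)
    (hε₃ : B₂ / ρ + η ≤ ε₃) (Q : Fin P.d → Fin M) (hQ : st Q = 3) (b : PBond P 0)
    (hbs : ∀ κ, (b.src κ - ((start (Q κ) : ℕ) : ZMod (P.sitesPerDir 0))).val ≤ len (Q κ))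
    (hbt : ∀ κ, (b.tgt κ - ((start (Q κ) : ℕ) : ZMod (P.sitesPerDir 0))).val ≤ len (Q κ)) :
    dist1 (w Q b.src * (w Q b.tgt)⁻¹) ≤ A₃ / ρ := by
  obtain ⟨h0, h1, h2⟩ := colour3_of_st κ0 κ1 κ2 st hst Q hQ
  have hodd : ∀ κ, ((Q κ : Fin M) : ℕ) % 2 = 1 := fun κ => by
    rcases htri κ with hκe | hκe | hκe <;> rw [hκe] <;> assumption
  rw [w_eq_W3 κ0 κ1 κ2 W₁ W₂ W₃ w hw Q b.src h0 h1 h2, w_eq_W3 κ0 κ1 κ2 W₁ W₂ W₃ w hw Q b.tgt h0 h1 h2]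
  refine hL3 Q (fun b' hs' ht' hfs hft => ?_) b hbs hbt
  obtain ⟨κs, hκs⟩ := hfs
  obtain ⟨κt, hκt⟩ := hft
  have hround := face_datum_step len start hlen1 hz hs hl hM hEven D hD κ0 κ1 κ2 htri g W₁ W₂ W₃ wle1 wle2 w hwle1 hwle2 hw hA1 hA2 hA3
    st hst hlen2 hN (B := B₂) (ρ := ρ) hTrans Q (fun R hR b'' hs'' ht'' => hlow R (by omega) b'' hs'' ht'') b' hs' ht'
    ⟨κs, hodd κs, hκs⟩ ⟨κt, hodd κt, hκt⟩
  rw [dkey3 len start hEven D hD κ0 κ1 κ2 htri W₁ W₂ W₃ wle2 w hwle2 hw Q b'.src h0 h1 h2 ⟨κs, hκs⟩,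
    dkey3 len start hEven D hD κ0 κ1 κ2 htri W₁ W₂ W₃ wle2 w hwle2 hw Q b'.tgt h0 h1 h2 ⟨κt, hκt⟩]
  linarith

end Blocks

end Summit.QuantumFields.YangMills.Theorems.FluctuationComparisonRegPrIntLS2BetaSectionsStageSteps
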